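import Literature.Computability.Complexity.OracleCompositionMachine
import Literature.Computability.Complexity.OracleQueryMap
import Literature.Computability.Complexity.TruthTableFunctions
import HarnessLib

/-!
# Composition of oracle algorithms, uniformly in the oracles; clocked runs; truth-table transducers against arbitrary oracles

Topic `Literature/Computability/Complexity`, companion of `OracleComposition.lean` /
`OracleCompositionMachine.lean` (the composite machine `OracleComposition.compose M N eb prm`
answering each query of `M` by running `N`, polynomial-time by
`OracleAlg.isPolyTime_compose_holds`), of `OracleQueryMap.lean` (the clocked algorithm
`OracleAlg.clock`) and of `TruthTableFunctions.lean` (the non-adaptive transducer `ttFnAlg`).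
Theorems only, all routine bookkeeping in the transcript model of `Oracle.lean`:

* **`OracleAlg.exists_polyTime_compose_uniform`** — the master composition theorem
  `OracleAlg.exists_polyTime_of_mem_FPRel` (`f ∈ FP^O ⟹ M^f` is simulated by a polynomial-time
  machine with oracle `O`) with its hypotheses made POINTWISE: ONE polynomial-time machine `C` and
  ONE polynomial `qC`, depending only on `M`, `N` and the two resource polynomials, such that for
  EVERY pair of oracles `(O, f)` and every input `x` on which `M` with `f` outputs `b` within
  `qM |x|` rounds with short queries and `N` with `O` computes `f` on the queries of that run, `C`
  with `O` outputs `b` within `qC |x|` rounds with short queries. (The composite machine of the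
  tree does not depend on the oracles; only the statement of `exists_polyTime_of_mem_FPRel` fixes
  them first.) This is the form needed when a reduction is run against a FAMILY of oracles, e.g. a
  `BPP` machine simulated by one oracle adversary against every member of a function ensemble
  (Aaronson–Chen 2017, proof of Thm. 7.6).
* `OracleAlg.runAux_clock_eq_default`, **`OracleAlg.run_clock_eq_some_iff`** — the clocked
  algorithm `M.clock q b₀` outputs `b ≠ b₀` within `n > q |x|` rounds iff `M` outputs `b` within
  `q |x|` rounds (past the clock only the default appears).
* `trans_ttFnAlg_oracle`, **`run_ttFnAlg_oracle`**, `exists_of_mem_queries_ttFnAlg_oracle` — the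
  truth-table transducer `ttFnAlg Q q G` against an ARBITRARY oracle `O` (not only a language
  oracle): within any budget of more than `q |x|` rounds it outputs
  `G ⟨x, (O (Q ⟨x,1⁰⟩)) ⋯ (O (Q ⟨x,1^{q|x|-1}⟩))⟩` (answers concatenated), asking only the intended
  queries.
* `length_le_one_of_mem_trans_ofLanguage` — transcripts of a language oracle consist of
  one-symbol answers.

## References

* R. E. Ladner, N. A. Lynch, A. L. Selman, *A comparison of polynomial time reducibilities*,
  Theoret. Comput. Sci. 1 (1975) 103–123, §2 (transitivity of `≤ᵀᴾ`: "answer each query of the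
  first procedure by running the second"), §3 (`≤ᵖₜₜ`) [LadnerLynchSelman1975].
* S. Arora, B. Barak, *Computational Complexity: A Modern Approach*, CUP 2009, §3.4 (oracle
  machines; clocks), Claim 1.6 / proof of Thm. 2.8 (polynomial-time computations compose)
  [AroraBarak2009].
* S. Aaronson, L. Chen, *Complexity-theoretic foundations of quantum supremacy experiments*,
  CCC 2017 (arXiv:1612.05903), proof of Thm. 7.6 (p. 30), as the consumer
  (`Literature/Computability/Cryptography/ZhandryOracleProofs.lean`) [AaronsonChen2017].
-/

namespace Literature.Computability.Complexity

open _root_.Computability Polynomial PRelSigma OracleCompose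

namespace OracleAlg

variable {β : Type}

/-! ### Composition, uniformly in the oracles -/

/-- **Composition of polynomial-time oracle algorithms, uniformly in the oracles.** For
polynomial-time `M` (outputs coded by `eb`) and `N` (string outputs) and polynomials `qM`, `qN`
there are a polynomial-time oracle algorithm `C` and a polynomial `qC` such that, for every pair
of oracles `O`, `f`, every input `x` and output `b`: if `M` with oracle `f` outputs `b` within
`qM |x|` rounds asking queries of length `≤ qM |x|`, and on every query `u` of that run `N` with
oracle `O` outputs `f u` within `qN |u|` rounds asking queries of length `≤ qN |u|`, then `C` with
oracle `O` outputs `b` within `qC |x|` rounds asking queries of length `≤ qC |x|`. (`C` is the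
composite machine `OracleComposition.compose M N eb prm` of the tree, with resource parameters
chosen from output-length bounds of the two step functions; the proof is the bookkeeping of
`exists_polyTime_of_mem_FPRel`, localised.) [Ladner–Lynch–Selman 1975, §2; Arora–Barak 2009,
§3.4 with Claim 1.6] [cite: LadnerLynchSelman1975, §2] [cite: AroraBarak2009, §3.4] -/
theorem exists_polyTime_compose_uniform {eb : Encoding β Bool} {M : OracleAlg β}
    (hM : M.IsPolyTime eb) {N : OracleAlg (List Bool)} (hN : N.IsPolyTime (encodingList Bool))
    (qM qN : Polynomial ℕ) :
    ∃ C : OracleAlg β, C.IsPolyTime eb ∧ ∃ qC : Polynomial ℕ,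
      ∀ (O f : Oracle) (x : List Bool) (b : β),
        M.run f (qM.eval x.length) x = some b →
        (∀ y ∈ M.queries f (qM.eval x.length) x, y.length ≤ qM.eval x.length) →
        (∀ u ∈ M.queries f (qM.eval x.length) x,
          N.run O (qN.eval u.length) u = some (f u) ∧
            ∀ y ∈ N.queries O (qN.eval u.length) u, y.length ≤ qN.eval u.length) →
        C.run O (qC.eval x.length) x = some b ∧
          ∀ y ∈ C.queries O (qC.eval x.length) x, y.length ≤ qC.eval x.length := by
  classical
  obtain ⟨RM, hRM⟩ := hM.exists_length_le
  obtain ⟨RN, hRN⟩ := hN.exists_length_le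
  -- the bounding polynomials (in the input length `n ≥ |x|` of the composite step function)
  let Kq : Polynomial ℕ := qN.comp qM
  let E : Polynomial ℕ := 2 * qM + 2 + Polynomial.X
  let F : Polynomial ℕ := RN.comp E
  let Lb : Polynomial ℕ := 2 * qM + 2 + qM * (2 * F + 2)
  let B : Polynomial ℕ := RM.comp (2 * Polynomial.X + 2 + Lb)
  let Pd : Polynomial ℕ := qM * (Kq + 2) + 1
  let P : Polynomial ℕ := qM + Kq + F + B + Pd
  obtain ⟨prm, hprm, hC⟩ := isPolyTime_compose_holds β eb M N hM hN P
  refine ⟨OracleComposition.compose M N eb prm, hC, qM * Kq + Kq + 1,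
    fun O f x b hMrun hMq hNrun => ?_⟩
  set m := x.length with hm
  -- the trace of `M` with oracle `f` on `x`
  obtain ⟨us, huslen, hstep, hout, hus⟩ := M.exists_trace_of_runAux f x (qM.eval m) [] b hMrun
  simp only [List.nil_append] at hstep hout
  have hmem : ∀ u ∈ us, u ∈ M.queries f (qM.eval m) x := fun u hu => by
    rw [OracleAlg.queries, hus]; exact hu
  have hub : ∀ u ∈ us, u.length ≤ qM.eval m := fun u hu => hMq u (hmem u hu)
  -- `N` computes `f` on every query of `M`, within `kN` rounds
  set kN := Kq.eval m with hkN
  have hkN' : ∀ u ∈ us, qN.eval u.length ≤ kN := fun u hu => by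
    rw [hkN]; simpa [Kq] using TM2Iter.eval_mono qN (hub u hu)
  have hNrun' : ∀ u ∈ us, N.run O kN u = some (f u) := fun u hu =>
    N.run_mono O u (hkN' u hu) (hNrun u (hmem u hu)).1
  have hNq : ∀ u ∈ us, ∀ q ∈ N.queries O kN u, q.length ≤ kN := fun u hu q hq => by
    have heq : N.queries O kN u = N.queries O (qN.eval u.length) u :=
      N.queriesAux_eq_of_runAux_eq_some O u (hkN' u hu) (hNrun u (hmem u hu)).1
    rw [heq] at hq
    exact ((hNrun u (hmem u hu)).2 q hq).trans (hkN' u hu)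
  have hvlen : ∀ u ∈ us, (N.queries O kN u).length < kN := fun u hu => by
    obtain ⟨ws, hw, -, -, hws⟩ := N.exists_trace_of_runAux O u kN [] (f u) (hNrun' u hu)
    rw [OracleAlg.queries, hws]; exact hw
  -- size of the global query sequence
  have hQlen : (us.flatMap fun u => N.queries O kN u).length ≤ qM.eval m * kN := by
    rw [List.length_flatMap]
    exact (OracleComposition.sum_map_le_length_mul us _ kN fun u hu => (hvlen u hu).le).trans
      (Nat.mul_le_mul_right _ huslen.le)
  have hK : (us.flatMap fun u => N.queries O kN u).length < (qM * Kq + Kq + 1).eval m := by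
    simp only [Polynomial.eval_add, Polynomial.eval_mul, Polynomial.eval_one, ← hkN]
    nlinarith [hQlen]
  -- the run of the composite machine
  have hrun := OracleComposition.compose_runAux_eq (eb := eb) O f kN prm x b us hstep hout
    hNrun' ?_ hK
  · refine ⟨hrun.1, fun y hy => ?_⟩
    rw [OracleAlg.queries, hrun.2, List.mem_flatMap] at hy
    obtain ⟨u, hu, hy⟩ := hy
    have := hNq u hu y hy
    simp only [Polynomial.eval_add, Polynomial.eval_mul, Polynomial.eval_one, ← hkN]
    nlinarith
  -- the resource parameters suffice at every stage `j`
  intro j hj n hn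
  have hmn : m ≤ n := by rw [hn, OracleComposition.inputLength_eq]; omega
  have hPb : P.eval n ≤ prm.bndOf n := (hprm n).1
  have hPeval : P.eval n = qM.eval n + Kq.eval n + F.eval n + B.eval n + Pd.eval n := by
    simp [P]
  have hA : qM.eval m ≤ qM.eval n := TM2Iter.eval_mono qM hmn
  have hKq : kN ≤ Kq.eval n := by rw [hkN]; exact TM2Iter.eval_mono Kq hmn
  -- (3) answers of `f` to completed queries
  have hfb : ∀ (i : ℕ) (hi : i < us.length),
      ((us.take (i + 1)).map fun u => (N.queries O kN u).length).sum ≤ j →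
        (f (us[i])).length + 1 ≤ F.eval n := by
    intro i hi hsum
    set u := us[i] with hu_def
    have hu : u ∈ us := List.getElem_mem hi
    obtain ⟨ws, -, -, hwo, hws⟩ := N.exists_trace_of_runAux O u kN [] (f u) (hNrun' u hu)
    simp only [List.nil_append] at hwo
    have hws' : N.queries O kN u = ws := hws
    -- the answers fed to `N` on `u` are among the available answers
    have hsub : (ws.map O).Sublist (((us.flatMap fun u => N.queries O kN u).take j).map O) := by
      rw [← hws']
      exact (OracleComposition.sublist_take_flatMap us (fun u => N.queries O kN u) i j hi hsum).map O
    have h1 := hRN u (ws.map O)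
    rw [hwo] at h1
    have h2 : (boolPair u ((encodingList Bool).listBool.encode (ws.map O))).length ≤ E.eval n := by
      rw [length_boolPair]
      have := OracleComposition.length_listBool_encode_le_of_sublist hsub
      have := hub u hu
      have hansn : ((encodingList Bool).listBool.encode
          (((us.flatMap fun u => N.queries O kN u).take j).map O)).length ≤ n := by
        rw [hn, OracleComposition.inputLength_eq]; omega
      simp only [E, Polynomial.eval_add, Polynomial.eval_mul, Polynomial.eval_ofNat,
        Polynomial.eval_X]
      omega
    have h3 : RN.eval (boolPair u ((encodingList Bool).listBool.encode (ws.map O))).length ≤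
        F.eval n := by
      simp only [F, Polynomial.eval_comp]
      exact TM2Iter.eval_mono RN h2
    have h4 : (((encodingList Bool).sumBool (encodingList Bool)).encode
        (Sum.inr (f u) : List Bool ⊕ List Bool)).length = (f u).length + 1 := by
      simp [Encoding.sumBool, encodingList]
    omega
  refine ⟨fun u hu => (hub u hu).trans (hA.trans (by omega)),
    fun u hu q hq => (hNq u hu q hq).trans (hKq.trans (by omega)),
    fun i hi hsum => by have := hfb i hi hsum; omega, fun hsum => ?_, ?_, ?_⟩
  · -- (4) the output of `M`
    have hall : ∀ (i : ℕ) (hi : i < us.length), (f (us[i])).length + 1 ≤ F.eval n := by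
      intro i hi
      refine hfb i hi ((List.Sublist.sum_le_sum ?_ (fun _ _ => Nat.zero_le _)).trans hsum)
      exact (List.take_sublist _ _).map _
    have hLb : ((encodingList Bool).listBool.encode (us.map f)).length ≤ Lb.eval n := by
      rw [OracleComposition.length_listBool_encode, List.length_map, List.map_map]
      have hs : (us.map ((fun a : List Bool => 2 * a.length + 2) ∘ f)).sum ≤
          us.length * (2 * F.eval n + 2) := by
        refine OracleComposition.sum_map_le_length_mul us _ _ fun u hu => ?_
        obtain ⟨i, hi, rfl⟩ := List.getElem_of_mem hu
        have := hall i hi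
        simp only [Function.comp_apply]
        omega
      have hl : us.length * (2 * F.eval n + 2) ≤ qM.eval n * (2 * F.eval n + 2) :=
        Nat.mul_le_mul_right _ (huslen.le.trans hA)
      simp only [Lb, Polynomial.eval_add, Polynomial.eval_mul, Polynomial.eval_ofNat]
      omega
    have h1 := hRM x (us.map f)
    rw [hout] at h1
    have h2 : (boolPair x ((encodingList Bool).listBool.encode (us.map f))).length ≤
        (2 * Polynomial.X + 2 + Lb).eval n := by
      rw [length_boolPair]
      simp only [Polynomial.eval_add, Polynomial.eval_mul, Polynomial.eval_ofNat, Polynomial.eval_X]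
      omega
    have h3 := TM2Iter.eval_mono RM h2
    have h4 : (((encodingList Bool).sumBool eb).encode (Sum.inr b : List Bool ⊕ β)).length =
        (eb.encode b).length + 1 := by
      simp [Encoding.sumBool]
    have hB : B.eval n = RM.eval ((2 * Polynomial.X + 2 + Lb).eval n) := by
      simp only [B, Polynomial.eval_comp]
    omega
  · -- (5) fuel
    have h1 : (us.map fun u => (N.queries O kN u).length + 2).sum ≤ us.length * (kN + 2) :=
      OracleComposition.sum_map_le_length_mul us _ _ fun u hu => by have := hvlen u hu; omega
    have h2 : us.length * (kN + 2) ≤ qM.eval n * (Kq.eval n + 2) :=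
      Nat.mul_le_mul (huslen.le.trans hA) (by omega)
    have h3 : Pd.eval n ≤ prm.padOf n := by
      have := (hprm n).2.1; rw [hPeval] at this; omega
    simp only [Pd, Polynomial.eval_add, Polynomial.eval_mul, Polynomial.eval_ofNat,
      Polynomial.eval_one] at h3
    omega
  · -- (6) micro-steps
    have h1 : (us.map fun u => (N.queries O kN u).length + 1).sum ≤ us.length * (kN + 2) :=
      OracleComposition.sum_map_le_length_mul us _ _ fun u hu => by have := hvlen u hu; omega
    have h2 : us.length * (kN + 2) ≤ qM.eval n * (Kq.eval n + 2) :=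
      Nat.mul_le_mul (huslen.le.trans hA) (by omega)
    have h3 : Pd.eval n ≤ prm.iterOf n := by
      have := (hprm n).2.2; rw [hPeval] at this; omega
    simp only [Pd, Polynomial.eval_add, Polynomial.eval_mul, Polynomial.eval_ofNat,
      Polynomial.eval_one] at h3
    omega

/-! ### Clocked runs: past the clock only the default appears -/

/-- If `M` has not produced an output within the `d` rounds left on the clock after the
transcript `as` (`|as| + d = q |x|`), then every output of the clocked algorithm `M.clock q b₀`
from `as` is the default `b₀`. [Arora–Barak 2009, §3.4 with §1.4.1] [cite: AroraBarak2009, §3.4] -/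
theorem runAux_clock_eq_default (M : OracleAlg β) (q : Polynomial ℕ) (b₀ : β) (O : Oracle)
    (x : List Bool) :
    ∀ (d : ℕ) (as : List (List Bool)), as.length + d = q.eval x.length →
      M.runAux O x d as = none →
        ∀ (n : ℕ) (b : β), (M.clock q b₀).runAux O x n as = some b → b = b₀
  | 0, as, h, _, n, b, hb => by
    cases n with
    | zero => simp at hb
    | succ n =>
      rw [runAux_succ, clock_step, if_neg (by omega)] at hb
      simpa using hb.symm
  | d + 1, as, h, hnone, n, b, hb => by
    cases n with
    | zero => simp at hb
    | succ n =>
      rw [runAux_succ, clock_step, if_pos (by omega)] at hb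
      rw [runAux_succ] at hnone
      cases hs : M.step x as with
      | inr b' => rw [hs] at hnone; simp at hnone
      | inl y =>
        rw [hs] at hb hnone
        exact runAux_clock_eq_default M q b₀ O x d (as ++ [O y]) (by simp; omega) hnone n b hb

/-- **The clocked algorithm outputs a non-default value iff the original does within the
clock.** For `b ≠ b₀` and any budget `n > q |x|`:
`(M.clock q b₀).run O n x = some b ↔ M.run O (q |x|) x = some b`.
[Arora–Barak 2009, §3.4 with §1.4.1] [cite: AroraBarak2009, §3.4] -/
theorem run_clock_eq_some_iff (M : OracleAlg β) (q : Polynomial ℕ) {b₀ b : β} (hb : b ≠ b₀)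
    (O : Oracle) (x : List Bool) {n : ℕ} (hn : q.eval x.length < n) :
    (M.clock q b₀).run O n x = some b ↔ M.run O (q.eval x.length) x = some b := by
  constructor
  · intro h
    cases hM : M.run O (q.eval x.length) x with
    | some b' =>
      have h' := M.run_clock_of_run q b₀ O x hM hn.le
      rw [h] at h'
      simpa using h'.symm
    | none =>
      exact absurd (runAux_clock_eq_default M q b₀ O x (q.eval x.length) [] (by simp) hM n b h) hb
  · intro h
    exact M.run_clock_of_run q b₀ O x h hn.le

/-! ### Transcripts of language oracles -/

/-- The free-running transcript of `M` against a LANGUAGE oracle consists of one-symbol answers.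
[Arora–Barak 2009, §3.4] [cite: AroraBarak2009, §3.4] -/
theorem length_le_one_of_mem_trans_ofLanguage (M : OracleAlg β) (A : Language Bool)
    (x : List Bool) : ∀ (i : ℕ), ∀ a ∈ trans M (Oracle.ofLanguage A) x i, a.length ≤ 1
  | 0, a, ha => by simp at ha
  | i + 1, a, ha => by
    rw [trans_succ, List.mem_append, List.mem_singleton] at ha
    rcases ha with ha | rfl
    · exact length_le_one_of_mem_trans_ofLanguage M A x i a ha
    · rw [ofLanguage_eq_singleton]; simp

end OracleAlg

/-! ### Truth-table transducers against arbitrary oracles -/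

section TTFnOracle

variable {Q : List Bool → List Bool} {q : Polynomial ℕ} {G : List Bool → List Bool}

/-- **The transcript of `ttFnAlg` against an arbitrary oracle** is the list of answers to the
intended queries `Q ⟨x, 1⁰⟩, …, Q ⟨x, 1^{i-1}⟩`. [Ladner–Lynch–Selman 1975, §3] [cite: LadnerLynchSelman1975, §3] -/
theorem trans_ttFnAlg_oracle (O : Oracle) (x : List Bool) :
    ∀ i ≤ q.eval x.length, trans (ttFnAlg Q q G) O x i =
      (List.range i).map fun k => O (Q (boolPair x (List.replicate k true)))
  | 0, _ => by simp
  | i + 1, hi => by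
    have ih := trans_ttFnAlg_oracle O x i (Nat.le_of_succ_le hi)
    rw [trans_succ, ih, qryOf_eq_of_step_eq (ttFnAlg_step_of_lt x (by simpa using hi)),
      List.range_succ, List.map_append, List.map_singleton, List.length_map, List.length_range]

/-- **`ttFnAlg` against an arbitrary oracle** outputs `G ⟨x, concatenated answers⟩` within any
budget of more than `q(|x|)` rounds. [Ladner–Lynch–Selman 1975, §3] [cite: LadnerLynchSelman1975, §3] -/
theorem run_ttFnAlg_oracle (O : Oracle) (x : List Bool) {n : ℕ} (hn : q.eval x.length < n) :
    (ttFnAlg Q q G).run O n x =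
      some (G (boolPair x ((List.range (q.eval x.length)).map fun k =>
        O (Q (boolPair x (List.replicate k true)))).flatten)) := by
  rw [run_eq_some_iff]
  refine ⟨q.eval x.length, hn, fun i hi => ⟨Q (boolPair x (List.replicate i true)), ?_⟩, ?_⟩
  · rw [trans_ttFnAlg_oracle O x i hi.le, ttFnAlg_step_of_lt x (by simpa using hi), List.length_map,
      List.length_range]
  · rw [trans_ttFnAlg_oracle O x _ le_rfl, ttFnAlg_step_of_le x (by simp)]

/-- **The queries of `ttFnAlg` against an arbitrary oracle are the intended ones.** [folklore] -/
theorem exists_of_mem_queries_ttFnAlg_oracle (O : Oracle) (x : List Bool) {n : ℕ} {y : List Bool}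
    (hy : y ∈ (ttFnAlg Q q G).queries O n x) :
    ∃ i < q.eval x.length, y = Q (boolPair x (List.replicate i true)) := by
  obtain ⟨i, -, hall, rfl⟩ := exists_of_mem_queries _ _ n x y hy
  have hi : i < q.eval x.length := by
    by_contra hle
    obtain ⟨y', hy'⟩ := hall (q.eval x.length) (Nat.not_lt.1 hle)
    rw [trans_ttFnAlg_oracle O x _ le_rfl, ttFnAlg_step_of_le x (by simp)] at hy'
    cases hy'
  refine ⟨i, hi, ?_⟩
  rw [trans_ttFnAlg_oracle O x i hi.le, qryOf_eq_of_step_eq (ttFnAlg_step_of_lt x (by simpa using hi)),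
    List.length_map, List.length_range]

end TTFnOracle

end Literature.Computability.Complexity
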